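import Literature.NumberTheory.EllipticCurves.ModularJacobianModTwoMultiplicityOne
import Literature.NumberTheory.EllipticCurves.ModularJacobianTorsionNonvanishing
import Literature.Algebra.GroupRings.CharpolyQuotientRankTwoDescent
import Mathlib.Tactic
import HarnessLib

/-!
# Multiplicity one for `J₀(N)[𝔪]` from an abstract Galois datum (Buzzard 2000, proof of Prop. 2.4)

The cited fact `buzzard2000_multiplicityOne_gamma0` (`ModularJacobianModTwoMultiplicityOne.lean`:
Buzzard, *On level-lowering for mod 2 representations* [Buzzard2000LevelLoweringModTwo], Prop. 2.4
with Def. 2.1–2.2) asserts `dim_{𝕋/𝔪} J₀(N)[𝔪] = 2`. Its printed proof (p. 101, with the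
appendix to Ribet–Stein [RibetStein2008], Thm. 6.1) runs: (i) `G_ℚ` acts `𝕋/𝔪`-linearly on
`J₀(N)[𝔪]` and, by the Eichler–Shimura relation and Chebotarev, every `g` is annihilated there by
the characteristic polynomial of `ρ(g)`, `ρ ≅ ρ_𝔪` absolutely irreducible; (ii) Lemma 2.3
(⟸ Ling–Oesterlé): `G_ℚ` acts on the kernel of `π^* : J₀(N) → J₁(N)` through an abelian
quotient; (iii) appendix Thm. 6.1 (⟸ Edixhoven 1992 Thm. 9.2 / Gross / Fontaine): `J₁(N)[𝔪]`
is `2`-dimensional, so `J₀(N)[𝔪] / (J₀(N)[𝔪] ∩ ker π^*)` has dimension `≤ 2`; (iv) Boston–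
Lenstra–Ribet and `J₀(N)[𝔪] ≠ 0`.

This file proves the fact FROM exactly the datum (i)–(iii), typed WITHOUT any new carrier: the
datum is an existential over a `𝕋/𝔪`-linear action `σ` of a group on the tree's
`J0 N[𝔪] = Submodule.torsionBySet (HeckeRing0 N 2) (J0 N) 𝔪`, scalar data `t, n` matching
`tr ρ`, `det ρ` under `ι : 𝕋/𝔪 → k`, and a `σ`-stable subspace `U` (print: `J₀(N)[𝔪] ∩ ker π^*`)
with commuting action and `dim (J0 N[𝔪] ⧸ U) ≤ 2`. Step (iv) is kernel: Boston–Lenstra–Ribet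
(`Literature/Algebra/GroupRings/CharpolyQuotientRankTwo*.lean`), its residue-field descent and the
assembly (`CharpolyQuotientRankTwoDescent.lean`), the lower bound `J0.finrank_torsionBySet_pos`
(`ModularJacobianTorsionNonvanishing.lean`), and Burnside's theorem
(`Literature.Algebra.GroupRings.lift_surjective_of_isIrreducible`; the framed-representation
bridge is re-derived here in three lines, cf. `FramedRep.lift_coe_surjective_of_isIrreducible` in
`GaloisRepresentations/FramedRepCharpolyModules.lean`, to keep this file's imports minimal).

* `finrank_torsionBySet_J0_eq_two_of_abstractDatum` — pointwise, for ANY `N`, maximal `𝔪 ∋ ℓ ≠ 0`,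
  field `k ⊇ 𝕋/𝔪`, any group `G` and `ρ : G → M₂(k)` with `lift ρ` onto: the datum forces
  `dim_{𝕋/𝔪} J0 N[𝔪] = 2`.
* `buzzard2000_multiplicityOne_gamma0_of_abstractGaloisDatum` — the cited fact from the datum
  stated in the fact's own binders (`G = G_ℚ`, `ρ : ModPGaloisRep ℚ k 2` irreducible over `k`
  algebraically closed).

HONESTY. This is a REDUCTION, not a discharge: the datum is what the printed proof supplies from
the `G_ℚ`-module structure of `J₀(N)[2]` (Eichler–Shimura, Chebotarev), Ling–Oesterlé and the
`J₁(N)` multiplicity-one theorem — none of which the tree has; `buzzard2000_multiplicityOne_gamma0`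
remains a cited input and no summit statement is proved here.

## References
* K. Buzzard, Math. Res. Lett. 7 (2000) 95–110 [Buzzard2000LevelLoweringModTwo], Lemma 2.3, Prop. 2.4
  and its proof (p. 101).
* K. Ribet, W. Stein, Lectures on Serre's conjectures [RibetStein2008], §3.3; appendix (K. Buzzard)
  Thm. 6.1.
* N. Boston, H. W. Lenstra, K. A. Ribet [BostonLenstraRibet1991], Thm. 1.
-/

noncomputable section

open scoped MatrixGroups ModularForm NumberField

open CongruenceSubgroup Polynomial IsDedekindDomain

namespace Literature.NumberTheory.EllipticCurves.ModularForms

open GaloisRepresentations Rat.HeightOneSpectrum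

section Pointwise

variable (N : ℕ) [NeZero N]

/-- **Multiplicity one from an abstract datum, pointwise** (the mechanism of Buzzard 2000, proof of
Prop. 2.4, p. 101, for one level `N` and one maximal ideal `𝔪 ∋ ℓ ≠ 0` of `𝕋_ℤ`). Let
`F = 𝕋/𝔪 → k` be fields, `G` a group, `ρ : G → M₂(k)` multiplicative with
`MonoidAlgebra.lift ρ : k[G] → M₂(k)` onto (absolute irreducibility). Suppose `G` acts
`F`-linearly on `V = J0 N[𝔪]` by `σ` with `σ(g)² - t(g) σ(g) + n(g) = 0`, `ι(t g) = tr ρ(g)`,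
`ι(n g) = det ρ(g)` for all `g` (print: Eichler–Shimura + Chebotarev), and that some `σ`-stable
`F`-subspace `U ≤ V` carries a commutative `σ`-action (print: `U = V ∩ ker(J₀(N) → J₁(N))`,
Lemma 2.3) with `dim_F (V ⧸ U) ≤ 2` (print: `V/U ↪ J₁(N)[𝔪]`, `2`-dimensional). Then
`dim_F V = 2`. (Assembly `finrank_eq_two_of_charpolyRel_of_commute_on_ker` at `π = U.mkQ`, with
`0 < dim_F V` from `J0.finrank_torsionBySet_pos`.)
[cite: Buzzard2000LevelLoweringModTwo, proof of Prop. 2.4 (p. 101)] -/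
theorem finrank_torsionBySet_J0_eq_two_of_abstractDatum (𝔪 : Ideal (HeckeRing0 N 2)) [𝔪.IsMaximal]
    {ℓ : ℕ} (hℓ : ℓ ≠ 0) (hℓ𝔪 : (ℓ : HeckeRing0 N 2) ∈ 𝔪)
    {k : Type*} [Field k] (ι : HeckeRing0 N 2 ⧸ 𝔪 →+* k)
    {G : Type*} [Group G] (ρ : G →* Matrix (Fin 2) (Fin 2) k)
    (hρ : Function.Surjective (MonoidAlgebra.lift k (Matrix (Fin 2) (Fin 2) k) G ρ))
    (σ : Representation (HeckeRing0 N 2 ⧸ 𝔪) G (Submodule.torsionBySet (HeckeRing0 N 2) (J0 N) 𝔪))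
    (t n : G → HeckeRing0 N 2 ⧸ 𝔪)
    (hrel : ∀ g : G, ι (t g) = (ρ g).trace ∧ ι (n g) = (ρ g).det ∧
      σ g * σ g - t g • σ g + n g •
        (1 : Module.End (HeckeRing0 N 2 ⧸ 𝔪) (Submodule.torsionBySet (HeckeRing0 N 2) (J0 N) 𝔪)) = 0)
    (U : Submodule (HeckeRing0 N 2 ⧸ 𝔪) (Submodule.torsionBySet (HeckeRing0 N 2) (J0 N) 𝔪))
    (hU : ∀ (g : G), ∀ x ∈ U, σ g x ∈ U)
    (hcomm : ∀ (g h : G), ∀ x ∈ U, σ g (σ h x) = σ h (σ g x))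
    (hdim : Module.finrank (HeckeRing0 N 2 ⧸ 𝔪)
      (Submodule.torsionBySet (HeckeRing0 N 2) (J0 N) 𝔪 ⧸ U) ≤ 2) :
    Module.finrank (HeckeRing0 N 2 ⧸ 𝔪) (Submodule.torsionBySet (HeckeRing0 N 2) (J0 N) 𝔪) = 2 := by
  letI : Field (HeckeRing0 N 2 ⧸ 𝔪) := Ideal.Quotient.field 𝔪
  letI : Algebra (HeckeRing0 N 2 ⧸ 𝔪) k := ι.toAlgebra
  haveI : Finite (Submodule.torsionBySet (HeckeRing0 N 2) (J0 N) 𝔪) :=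
    J0.finite_torsionBySet N hℓ hℓ𝔪
  haveI : Module.Finite (HeckeRing0 N 2 ⧸ 𝔪) (Submodule.torsionBySet (HeckeRing0 N 2) (J0 N) 𝔪) :=
    Module.Finite.of_finite
  have h0 : 0 < Module.finrank (HeckeRing0 N 2 ⧸ 𝔪)
      (Submodule.torsionBySet (HeckeRing0 N 2) (J0 N) 𝔪) :=
    J0.finrank_torsionBySet_pos N 𝔪 hℓ hℓ𝔪
  have hk : ∀ x : Submodule.torsionBySet (HeckeRing0 N 2) (J0 N) 𝔪, U.mkQ x = 0 ↔ x ∈ U :=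
    fun x => by rw [← LinearMap.mem_ker, Submodule.ker_mkQ]
  have key := Literature.Algebra.GroupRings.finrank_eq_two_of_charpolyRel_of_commute_on_ker
    (F := HeckeRing0 N 2 ⧸ 𝔪) ρ hρ σ t n
    (fun g => by rw [RingHom.algebraMap_toAlgebra]; exact (hrel g).1)
    (fun g => by rw [RingHom.algebraMap_toAlgebra]; exact (hrel g).2.1)
    (fun g => (hrel g).2.2) U.mkQ
    (fun g x hx => (hk _).mpr (hU g x ((hk x).mp hx)))
    (fun g h x hx => hcomm g h x ((hk x).mp hx)) hdim h0
  exact key.2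

end Pointwise

section Buzzard

/-- The standard representation of the matrix-valued hom `g ↦ (ρ g : M₂(k))` of a framed
representation IS `ρ.toRepresentation` (both are `v ↦ ρ(g) v`). Private plumbing (the same
identity as in `GaloisRepresentations/FramedRepCharpolyModules.lean`). [folklore] -/
private theorem std_comp_coeHom_eq_toRepresentation {G : Type*} [Group G] [TopologicalSpace G]
    {k : Type*} [Field k] [TopologicalSpace k] {m : ℕ} (ρ : FramedRep G k m) :
    (Representation.ofDistribMulAction k (Matrix (Fin m) (Fin m) k) (Fin m → k)).comp
      ((Units.coeHom (Matrix (Fin m) (Fin m) k)).comp ρ.toMonoidHom) = ρ.toRepresentation := by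
  refine MonoidHom.ext fun g => LinearMap.ext fun v => ?_
  rw [FramedRep.toRepresentation_apply_apply, MonoidHom.comp_apply,
    Representation.ofDistribMulAction_apply_apply, Matrix.smul_eq_mulVec]
  rfl

/-- Burnside bridge for framed representations (as `FramedRep.lift_coe_surjective_of_isIrreducible`
in `GaloisRepresentations/FramedRepCharpolyModules.lean`, re-derived to keep imports minimal): over an
algebraically closed field an irreducible `ρ : G →ₜ* GL₂(k)` has `lift (g ↦ (ρ g : M₂(k)))` onto.
Private plumbing. [folklore] -/
private theorem lift_coe_surjective_of_isIrreducible' {G : Type*} [Group G] [TopologicalSpace G]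
    {k : Type*} [Field k] [TopologicalSpace k] [IsAlgClosed k] (ρ : FramedRep G k 2)
    (hirr : ρ.IsIrreducible) :
    Function.Surjective (MonoidAlgebra.lift k (Matrix (Fin 2) (Fin 2) k) G
      ((Units.coeHom (Matrix (Fin 2) (Fin 2) k)).comp ρ.toMonoidHom)) := by
  refine Literature.Algebra.GroupRings.lift_surjective_of_isIrreducible _ ?_
  rw [std_comp_coeHom_eq_toRepresentation]
  exact hirr

/-- **Buzzard 2000 Prop. 2.4 (the tree's `buzzard2000_multiplicityOne_gamma0`) FROM the abstract
Galois datum of its printed proof.** If, for every odd `N`, maximal `𝔪 ∋ 2`, algebraically closed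
`k ⊇ 𝕋/𝔪` (via `ι`) and `ρ : G_ℚ → GL₂(k)` satisfying the fact's hypotheses (`ρ ≅ ρ_𝔪` via
Eichler–Shimura characteristic polynomials, `ρ` irreducible, non-scalar on `D₂`), one is GIVEN
(i) a `𝕋/𝔪`-linear action `σ` of `G_ℚ` on `J0 N[𝔪]` with `σ(g)² - t(g)σ(g) + n(g) = 0`,
`ι(t g) = tr ρ(g)`, `ι(n g) = det ρ(g)` (print: the Galois module `J₀(N)(ℚ̄)[𝔪]`, Eichler–Shimura,
Chebotarev), and (ii)+(iii) a `σ`-stable `𝕋/𝔪`-subspace `U` with commuting action and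
`dim (J0 N[𝔪] ⧸ U) ≤ 2` (print: `U = J₀(N)[𝔪] ∩ ker(J₀(N) → J₁(N))`, Lemma 2.3 ⟸ Ling–Oesterlé,
and `dim J₁(N)[𝔪] = 2`, appendix Thm. 6.1), THEN the fact holds. Absolute irreducibility in
Burnside's form comes from `FramedRep.IsIrreducible ρ` over the algebraically closed `k`
(Burnside, `Literature.Algebra.GroupRings.lift_surjective_of_isIrreducible`). A reduction, not a proof of the input.
[cite: Buzzard2000LevelLoweringModTwo, proof of Prop. 2.4 (p. 101)] -/
theorem buzzard2000_multiplicityOne_gamma0_of_abstractGaloisDatum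
    (hD : ∀ (N : ℕ) [NeZero N], Odd N →
      ∀ (𝔪 : Ideal (HeckeRing0 N 2)), 𝔪.IsMaximal → (2 : HeckeRing0 N 2) ∈ 𝔪 →
      ∀ (k : Type) [Field k] [IsAlgClosed k] [TopologicalSpace k] [DiscreteTopology k]
        (ι : HeckeRing0 N 2 ⧸ 𝔪 →+* k) (ρ : ModPGaloisRep ℚ k 2),
        (∀ v : HeightOneSpectrum (𝓞 ℚ), ¬ ((primesEquiv v : Nat.Primes) : ℕ) ∣ 2 * N →
          ρ.IsUnramifiedAt v ∧
            ρ.HasFrobCharpolyAt v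
              (X ^ 2
                - C (ι (Ideal.Quotient.mk 𝔪 (HeckeRing0.T N 2
                    ((primesEquiv v : Nat.Primes) : ℕ) (primesEquiv v : Nat.Primes).2))) * X
                + C (((primesEquiv v : Nat.Primes) : ℕ) : k))) →
        FramedRep.IsIrreducible ρ →
        (∀ v : HeightOneSpectrum (𝓞 ℚ), ((primesEquiv v : Nat.Primes) : ℕ) = 2 →
          ∀ 𝔓 ∈ v.primesAbove, ∃ σ ∈ 𝔓.decompositionSubgroup (Field.absoluteGaloisGroup ℚ),
            ∀ c : k, ((ρ σ : GL (Fin 2) k) : Matrix (Fin 2) (Fin 2) k) ≠ Matrix.scalar (Fin 2) c) →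
        ∃ (σ : Representation (HeckeRing0 N 2 ⧸ 𝔪) (Field.absoluteGaloisGroup ℚ)
            (Submodule.torsionBySet (HeckeRing0 N 2) (J0 N) 𝔪))
          (t n : Field.absoluteGaloisGroup ℚ → HeckeRing0 N 2 ⧸ 𝔪)
          (U : Submodule (HeckeRing0 N 2 ⧸ 𝔪) (Submodule.torsionBySet (HeckeRing0 N 2) (J0 N) 𝔪)),
          (∀ g : Field.absoluteGaloisGroup ℚ,
            ι (t g) = ((ρ g : GL (Fin 2) k) : Matrix (Fin 2) (Fin 2) k).trace ∧
            ι (n g) = ((ρ g : GL (Fin 2) k) : Matrix (Fin 2) (Fin 2) k).det ∧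
            σ g * σ g - t g • σ g + n g •
              (1 : Module.End (HeckeRing0 N 2 ⧸ 𝔪)
                (Submodule.torsionBySet (HeckeRing0 N 2) (J0 N) 𝔪)) = 0) ∧
          (∀ (g : Field.absoluteGaloisGroup ℚ), ∀ x ∈ U, σ g x ∈ U) ∧
          (∀ (g h : Field.absoluteGaloisGroup ℚ), ∀ x ∈ U, σ g (σ h x) = σ h (σ g x)) ∧
          Module.finrank (HeckeRing0 N 2 ⧸ 𝔪)
            (Submodule.torsionBySet (HeckeRing0 N 2) (J0 N) 𝔪 ⧸ U) ≤ 2) :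
    buzzard2000_multiplicityOne_gamma0 := by
  intro N _ hN 𝔪 h𝔪 h2 k _ _ _ _ ι ρ hES hirr hns
  obtain ⟨σ, t, n, U, hrel, hU, hcomm, hdim⟩ := hD N hN 𝔪 h𝔪 h2 k ι ρ hES hirr hns
  haveI := h𝔪
  have hρ := lift_coe_surjective_of_isIrreducible' ρ hirr
  refine finrank_torsionBySet_J0_eq_two_of_abstractDatum N 𝔪 (ℓ := 2) two_ne_zero
    (by exact_mod_cast h2) ι ((Units.coeHom (Matrix (Fin 2) (Fin 2) k)).comp ρ.toMonoidHom) hρ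
    σ t n (fun g => ?_) U hU hcomm hdim
  simpa using hrel g

end Buzzard

end Literature.NumberTheory.EllipticCurves.ModularForms

end
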